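import Mathlib

/-!
# Route `SqueezedSkewness`, support `ThermalLimit` (stmt-QuantumFields-22661) — engine layer (A):
# THE THERMODYNAMIC LIMIT OF A RATIO OF SPECTRAL SUMS OF A POSITIVE TRANSFER OPERATOR

Pure real analysis (Mathlib only; theorems only, no definitions).  SETTING: an index type `ι` (the eigenbasis of a
transfer matrix), eigenvalues `0 ≤ λᵢ ≤ L` with `Σ λᵢ² < ∞` (Hilbert–Schmidt; `L = λ_{i₀}` the top eigenvalue, attained)
and bounded coefficients `|aᵢ| ≤ M` (`aᵢ = ⟪bᵢ, 𝕏 bᵢ⟫` for a bounded insertion operator `𝕏`).  Then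

* `tendsto_tsum_pow_mul_div_pow` — `(Σᵢ λᵢ^{n+2} aᵢ) / L^{n+2} → Σ_{i : λᵢ = L} aᵢ` as `n → ∞` (Tannery's theorem: each
  term `(λᵢ/L)^{n+2} aᵢ` converges — to `aᵢ` on the top eigenspace, to `0` off it — and is dominated by `M (λᵢ/L)²`);
* `one_le_tsum_top_indicator` — the top multiplicity `d₀ = Σᵢ [λᵢ = L] ≥ 1` (finite by `Σ λ² < ∞`);
* `tendsto_tsum_pow_mul_div_tsum_pow` (**main**) — the normalised one-insertion trace converges:
  `(Σᵢ λᵢ^{n+2} aᵢ) / (Σᵢ λᵢ^{n+2+m}) → (Σ_{i : λᵢ = L} aᵢ) / (d₀ · L^m)`, i.e. `Tr(𝕏 𝕋^{n+2}) / Tr(𝕋^{n+2+m})` has a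
  limit as the period `n → ∞` for every fixed insertion width `m` — NO spectral gap / simplicity of the top eigenvalue
  is needed (Lüscher positivity `λᵢ ≥ 0` suffices; with Jentzsch simplicity `d₀ = 1` and the limit is `⟪Ω, 𝕏 Ω⟫ / L^m`);
* `exists_tendsto_tsum_pow_mul_div_tsum_pow` — the `∃ Q, Tendsto … (𝓝 Q)` form along any sequence of periods `N k → ∞`.

This is the abstract half of the thermodynamic (infinite Euclidean time) limit of one-point functions of finite-width
observables in the transfer-matrix formalism (Montvay–Münster §1.5.2 (1.195)–(1.196): `⟨O⟩_N = Tr(Ô T^{N−w})/Tr T^N`).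
Width seat `ym-t4-w9` (cell ym-fleet), `--supports stmt-QuantumFields-22661`; no summit ∕ NT ∕ mass-gap statement is proved.

References: I. Montvay, G. Münster, *Quantum Fields on a Lattice* (1994) §1.5.2 (1.195)–(1.196); M. Lüscher,
Commun. Math. Phys. 54 (1977) 283; K. Osterwalder, E. Seiler, Ann. Phys. 110 (1978) 440, §3.
-/

set_option autoImplicit false

noncomputable section

open Filter Topology

namespace Summit.QuantumFields.YangMills.Theorems.SpectralSumLimit

variable {ι : Type*} {lam a : ι → ℝ} {L M : ℝ}

/-- `(λ/L)^{n+2} → [λ = L]` for `0 ≤ λ ≤ L`, `0 < L`. [cite: MontvayMunster1994, §1.5.2 (1.196)] -/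
theorem tendsto_pow_div_top {x : ℝ} (hL : 0 < L) (h0 : 0 ≤ x) (hle : x ≤ L) :
    Tendsto (fun n : ℕ => (x / L) ^ (n + 2)) atTop (𝓝 (if x = L then 1 else 0)) := by
  by_cases hx : x = L
  · simp [hx, div_self hL.ne']
  · rw [if_neg hx]
    have hlt : x / L < 1 := by
      rw [div_lt_one hL]
      exact lt_of_le_of_ne hle hx
    exact (tendsto_pow_atTop_nhds_zero_of_lt_one (div_nonneg h0 hL.le) hlt).comp
      (tendsto_add_atTop_nat 2)

/-- The dominating family `M' (λᵢ/L)²` (`M' = max M 0`) is summable when `Σ λᵢ² < ∞`. [cite: ReedSimonI1980, Thm. VI.22] -/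
theorem summable_bound (hsq : Summable fun i => lam i ^ 2) :
    Summable fun i => max M 0 * (lam i / L) ^ 2 := by
  have : (fun i => max M 0 * (lam i / L) ^ 2) = fun i => (max M 0 / L ^ 2) * lam i ^ 2 := by
    funext i; rw [div_pow]; ring
  rw [this]
  exact hsq.mul_left _

/-- Termwise domination: `|(λᵢ/L)^{n+2} aᵢ| ≤ M' (λᵢ/L)²`. [cite: MontvayMunster1994, §1.5.2 (1.196)] -/
theorem norm_term_le (hL : 0 < L) (h0 : ∀ i, 0 ≤ lam i) (hle : ∀ i, lam i ≤ L) (ha : ∀ i, |a i| ≤ M)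
    (n : ℕ) (i : ι) : ‖(lam i / L) ^ (n + 2) * a i‖ ≤ max M 0 * (lam i / L) ^ 2 := by
  have hq0 : 0 ≤ lam i / L := div_nonneg (h0 i) hL.le
  have hq1 : lam i / L ≤ 1 := (div_le_one hL).2 (hle i)
  rw [Real.norm_eq_abs, abs_mul, abs_of_nonneg (pow_nonneg hq0 _), pow_add, mul_comm]
  have hpn : (lam i / L) ^ n ≤ 1 := pow_le_one₀ hq0 hq1
  calc |a i| * ((lam i / L) ^ n * (lam i / L) ^ 2)
      ≤ max M 0 * (1 * (lam i / L) ^ 2) := by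
        apply mul_le_mul ((ha i).trans (le_max_left _ _)) _ (by positivity) (le_max_right _ _)
        exact mul_le_mul_of_nonneg_right hpn (pow_nonneg hq0 2)
    _ = max M 0 * (lam i / L) ^ 2 := by rw [one_mul]

/-- **`(Σᵢ λᵢ^{n+2} aᵢ) / L^{n+2} → Σ_{i : λᵢ = L} aᵢ`** (Tannery). [cite: MontvayMunster1994, §1.5.2 (1.196)] -/
theorem tendsto_tsum_pow_mul_div_pow (hL : 0 < L) (h0 : ∀ i, 0 ≤ lam i) (hle : ∀ i, lam i ≤ L)
    (hsq : Summable fun i => lam i ^ 2) (ha : ∀ i, |a i| ≤ M) :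
    Tendsto (fun n : ℕ => (∑' i, lam i ^ (n + 2) * a i) / L ^ (n + 2)) atTop
      (𝓝 (∑' i, if lam i = L then a i else 0)) := by
  have hrw : ∀ n : ℕ, (∑' i, lam i ^ (n + 2) * a i) / L ^ (n + 2) = ∑' i, (lam i / L) ^ (n + 2) * a i := by
    intro n
    rw [← tsum_div_const]
    refine tsum_congr fun i => ?_
    rw [div_pow]; ring
  simp_rw [hrw]
  refine tendsto_tsum_of_dominated_convergence (summable_bound (M := M) (L := L) hsq)
    (fun i => ?_) (Eventually.of_forall fun n i => norm_term_le hL h0 hle ha n i)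
  have h := (tendsto_pow_div_top hL (h0 i) (hle i)).mul_const (a i)
  refine h.congr' (Eventually.of_forall fun n => rfl) |>.trans ?_
  simp only [ite_mul, one_mul, zero_mul]
  exact le_rfl

/-- The top eigenspace is finite: `{i | λᵢ = L}` is a finite set when `Σ λᵢ² < ∞` and `L > 0`. [cite: ReedSimonI1980, Thm. VI.22] -/
theorem finite_top (hL : 0 < L) (hsq : Summable fun i => lam i ^ 2) : {i | lam i = L}.Finite := by
  have h := hsq.tendsto_cofinite_zero
  have hev : ∀ᶠ i in cofinite, lam i ^ 2 < L ^ 2 := by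
    have : Set.Iio (L ^ 2) ∈ 𝓝 (0 : ℝ) := Iio_mem_nhds (by positivity)
    exact h this
  have hfin : {i | ¬ (lam i ^ 2 < L ^ 2)}.Finite := Filter.eventually_cofinite.mp hev
  refine hfin.subset fun i hi => ?_
  simp only [Set.mem_setOf_eq] at hi ⊢
  rw [hi]
  exact lt_irrefl _

/-- **The top multiplicity is at least one**: `1 ≤ Σᵢ [λᵢ = L]` when the top eigenvalue is attained.
[cite: Luscher1977] -/
theorem one_le_tsum_top_indicator (hL : 0 < L) (hsq : Summable fun i => lam i ^ 2) {i₀ : ι} (hi₀ : lam i₀ = L) :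
    1 ≤ ∑' i, (if lam i = L then (1 : ℝ) else 0) := by
  have hfin := finite_top hL hsq
  have hsupp : Function.support (fun i => if lam i = L then (1 : ℝ) else 0) ⊆ hfin.toFinset := by
    intro i hi
    simp only [Function.mem_support, ne_eq, ite_eq_right_iff, one_ne_zero, imp_false, not_not] at hi
    simpa using hi
  rw [tsum_eq_sum (s := hfin.toFinset) (fun i hi => by
    by_contra h
    exact hi (hsupp (Function.mem_support.2 h)))]
  have hmem : i₀ ∈ hfin.toFinset := by simpa using hi₀
  calc (1 : ℝ) = (if lam i₀ = L then (1 : ℝ) else 0) := by rw [if_pos hi₀]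
    _ ≤ ∑ i ∈ hfin.toFinset, (if lam i = L then (1 : ℝ) else 0) :=
        Finset.single_le_sum (f := fun i => if lam i = L then (1 : ℝ) else 0)
          (fun i _ => by split_ifs <;> norm_num) hmem

/-- **MAIN — the normalised one-insertion trace has a thermodynamic limit**:
`(Σᵢ λᵢ^{n+2} aᵢ) / (Σᵢ λᵢ^{n+2+m}) → (Σ_{i : λᵢ = L} aᵢ) / ((Σᵢ [λᵢ = L]) · L^m)` (`0 ≤ λᵢ ≤ L`, `0 < L` attained,
`Σ λ² < ∞`, `|aᵢ| ≤ M`; no spectral gap needed). [cite: MontvayMunster1994, §1.5.2 (1.195)–(1.196)] [cite: Luscher1977] -/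
theorem tendsto_tsum_pow_mul_div_tsum_pow (hL : 0 < L) (h0 : ∀ i, 0 ≤ lam i) (hle : ∀ i, lam i ≤ L)
    (hsq : Summable fun i => lam i ^ 2) (ha : ∀ i, |a i| ≤ M) {i₀ : ι} (hi₀ : lam i₀ = L) (m : ℕ) :
    Tendsto (fun n : ℕ => (∑' i, lam i ^ (n + 2) * a i) / (∑' i, lam i ^ (n + 2 + m))) atTop
      (𝓝 ((∑' i, if lam i = L then a i else 0) / ((∑' i, if lam i = L then (1 : ℝ) else 0) * L ^ m))) := by
  -- numerator / L^{n+2}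
  have hnum := tendsto_tsum_pow_mul_div_pow hL h0 hle hsq ha
  -- denominator / L^{n+2} = ((Σ λ^{(n+m)+2} · 1) / L^{n+m+2}) · L^m
  have hden1 : Tendsto (fun n : ℕ => (∑' i, lam i ^ (n + 2) * (1 : ℝ)) / L ^ (n + 2)) atTop
      (𝓝 (∑' i, if lam i = L then (1 : ℝ) else 0)) :=
    tendsto_tsum_pow_mul_div_pow (a := fun _ => (1 : ℝ)) (M := 1) hL h0 hle hsq (fun i => by simp)
  have hden2 : Tendsto (fun n : ℕ => (∑' i, lam i ^ (n + m + 2) * (1 : ℝ)) / L ^ (n + m + 2)) atTop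
      (𝓝 (∑' i, if lam i = L then (1 : ℝ) else 0)) := hden1.comp (tendsto_add_atTop_nat m)
  have hden : Tendsto (fun n : ℕ => (∑' i, lam i ^ (n + 2 + m)) / L ^ (n + 2)) atTop
      (𝓝 ((∑' i, if lam i = L then (1 : ℝ) else 0) * L ^ m)) := by
    have h3 := hden2.mul_const (L ^ m)
    refine h3.congr fun n => ?_
    simp only [mul_one]
    have hLn : L ^ (n + 2) ≠ 0 := pow_ne_zero _ hL.ne'
    have hLnm : L ^ (n + m + 2) ≠ 0 := pow_ne_zero _ hL.ne'
    rw [show n + 2 + m = n + m + 2 by ring, div_mul_eq_mul_div, div_eq_div_iff hLnm hLn]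
    ring
  have hne : (∑' i, if lam i = L then (1 : ℝ) else 0) * L ^ m ≠ 0 :=
    mul_ne_zero (by linarith [one_le_tsum_top_indicator hL hsq hi₀]) (pow_ne_zero _ hL.ne')
  have h := hnum.div hden hne
  refine h.congr fun n => ?_
  have hLn : L ^ (n + 2) ≠ 0 := pow_ne_zero _ hL.ne'
  show ((∑' (i : ι), lam i ^ (n + 2) * a i) / L ^ (n + 2)) / ((∑' (i : ι), lam i ^ (n + 2 + m)) / L ^ (n + 2)) = _
  rw [div_div_div_cancel_right₀ hLn]

/-- **Existence form along a sequence of periods** `N k → ∞` (e.g. `N k = 2^k(2L+1) − w`): the normalised one-insertion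
trace `(Σᵢ λᵢ^{N k + 2} aᵢ) / (Σᵢ λᵢ^{N k + 2 + m})` converges. [cite: MontvayMunster1994, §1.5.2 (1.195)–(1.196)] -/
theorem exists_tendsto_tsum_pow_mul_div_tsum_pow (hL : 0 < L) (h0 : ∀ i, 0 ≤ lam i) (hle : ∀ i, lam i ≤ L)
    (hsq : Summable fun i => lam i ^ 2) (ha : ∀ i, |a i| ≤ M) {i₀ : ι} (hi₀ : lam i₀ = L) (m : ℕ)
    {N : ℕ → ℕ} (hN : Tendsto N atTop atTop) :
    ∃ Q : ℝ, Tendsto (fun k : ℕ => (∑' i, lam i ^ (N k + 2) * a i) / (∑' i, lam i ^ (N k + 2 + m))) atTop (𝓝 Q) :=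
  ⟨_, (tendsto_tsum_pow_mul_div_tsum_pow hL h0 hle hsq ha hi₀ m).comp hN⟩

end Summit.QuantumFields.YangMills.Theorems.SpectralSumLimit

end
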